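import Summits.QuantumFields.BalabanUV.Beta.GAN24.DirichletExhaustionDeltaZSymm
import Summits.QuantumFields.BalabanUV.Beta.GAN24.DirichletExhaustionDecays
import Summits.QuantumFields.BalabanUV.Beta.TameKernelCalculus

/-!
# `BalabanUV.Beta.D1BFx.CoarseLeg` — road «BF-x» for binder row D1, typer object T3: THE COARSE (unit-lattice) LEG `Cun n a` —
# Bałaban's `U = 1` block-field action kernel `Δ^{(n)}` on the bonds of the UNIT lattice `ℤ⁴` FOR EVERY BLOCK SIZE `n`, in the road's
# `MKer 4 (Fin 4)` currency, shifted by `a·𝟙`; `n`-UNIFORM exponential decay, symmetry, translation invariance, tameness — by name from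
# the G-an2-4 / t4-ne2-p2 lineages

HONEST FRAMING (cell contract, verbatim): «discharging `BetaPertH` makes Bałaban's UV stability UNCONDITIONAL — a real constructive-QFT
result; it is NOT the continuum limit and NOT the Clay problem.»  HONEST DEPENDENCY (verbatim): «continuum YM on T⁴ ⇐ BetaPertH ∧ nine
spine estimates (0/9 proved); BetaPertH ⇐ (D1) ∧ (D4) ∧ CAP+tail; G-an2-4 gates asym, D1 and NE2/3/4.»  THIS MODULE DISCHARGES NOTHING.
Two definitions with bodies over objects already in the tree (t4-ne2-p2's (1.66) entry kernels `T4GaugeActionRatePair.kerRe`, gan24-p2's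
bond-basis `summand` / `deltaZ`, the lead's `HessKerSchurResolvent.idK`) and the transfer of those lineages' theorems (`kerRe_decay`,
`kerRe_neg`, `summand_swap`, `abs_summand_le`, `abs_sum_sum_le`) to the road's currency.  No `Prop` is minted; nothing printed is
asserted; 0 sorry.  NOT summit progress; NOT BetaPertH, NOT continuum, NOT Clay.

ABSOLUTE RULE (cell, verbatim): «No internally-minted statement may enter as a cited fact. Every hypothesis is either kernel-proved in this
package or a verbatim quotation of a PUBLISHED theorem with page reference. The manuscript(s) under audit are NOT citable for their own
disputed steps — they are the thing under adjudication; programme-internal (2001/route/tribunal) claims are never citable.»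

WHY (skeleton `HOME/beta/skeletons/D1-b2b-balaban-beta-d1-p2.md` v1.4 nodes R/L5/A5, typer spec `TYPER-SPEC-D1BFx.md` §1 T3, claim table
`LEAVES-BFx.md` row T3).  In the REDUCED background-Feynman form (K-R2) the first step at block `n` has three leg species: gluon `Ga` (T1,
`D1BFx/GluonLeg`), ghost `Ggh` (T2) and the COARSE leg `Cun = (Q Ga Q*)⁻¹` between unit-lattice bonds, through which every
block-structured term and the unit pieces (A5) factor.  K-R2's dictionary reads `Cun` as «`Δ^{(n)} + a·𝟙`» with `Δ^{(n)}` Bałaban's block-field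
action ((1.66) of [Balaban1984PropagatorsI] p. 29, CONTEXT ONLY) — the object gan24-p2 typed on `ℤ^{d+1}` as `deltaZ L k` for `n = L^k`.
THIS FILE TYPES THE CANDIDATE: `CunZ n` = that kernel for EVERY `n` (not only powers), `Cun n a := CunZ n + a • idK`; the kernel-level
IDENTIFICATION `(Q Ga Q*)⁻¹ = Cun` (with whatever unit scalar the `n²`-normalisation of `Ga` forces) is K-R2's theorem to prove and is
NOT asserted here.  What IS proved is what the A-leaves consume: `n`-UNIFORM exponential decay on the unit lattice (the «no fine loop ⇒ no
`log n`» mechanism of A5 needs exactly `Decays (Cun n a) C κ` with `C, κ` free of `n`), symmetry, translation invariance, tameness.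

CONTENT (all [folklore] / [our object]).
* §1 `CunZ n : MKer 4 (Fin 4)` (`Σ_{μ ≠ ν} summand (kerRe n μ ν ··) μ ν β β′ (y − y′)`), `CunZ_apply`, **`CunZ_pow_eq_toMKer_deltaZ`**:
  `CunZ (L^k) = toMKer (deltaZ L k)` (rfl-grade) — so every G-an2-4 theorem about `deltaZ` (`convC_deltaZ`, `decayCauchy_deltaZ`,
  `opClose_deltaZ`, …) is a theorem about `CunZ` along `n = L^k`; `Cun n a := CunZ n + a • idK`, `Cun_apply`.
* §2 DECAY, `n`-UNIFORM, ℓ¹ currency: `abs_CunZ_le` / **`decays_CunZ : Decays (CunZ n) (c166Z 3) (kappaZ 3)`** (straight from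
  `kerRe_decay`, keeping the rate `kappaZ 3 = κ₁₆₆(4)/4` — no sup→ℓ¹ loss), **`decays_Cun : Decays (Cun n a) (c166Z 3 + |a|) (kappaZ 3)`**,
  `spr_CunZ`/`spr_Cun`, `tame_CunZ`/`tame_Cun` (`TameKernelCalculus.Spr.tame`: the coarse leg is a TAME kernel — row/column majorants exist,
  unlike the gluon leg), `bdd_Cun`.
* §3 SYMMETRY AND TRANSLATION INVARIANCE: `CunZ_symm`/`Cun_symm`/`trK_Cun` (`kerRe_neg` + `summand_swap`), `shiftK_CunZ`/`shiftK_Cun`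
  (invariance under EVERY unit-lattice translation — in particular the `covA` field of `ExpKernelCalculus.BlockCovariant` at any period).
-/

noncomputable section

namespace Summit.QuantumFields.BalabanUV.Beta.D1BFx.CoarseLeg

open Finset
open Literature.MathematicalPhysics.QuantumFieldTheory.Balaban1983to89
open Literature.MathematicalPhysics.QuantumFieldTheory.Balaban1983to89.Beta
open B12Sec2to5 (l1 l1_nonneg)
open B5Symbol166Strip (MG MG_pos)
open T4GaugeActionRatePair (kerRe kerFamily kerRe_decay)
open ExpKernelCalculus (Site MKer Decays shiftK)
open KernelWard (Bdd)
open HessKerSchurResolvent (idK idK_apply)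
open Summit.QuantumFields.BalabanUV.Beta.TameKernelCalculus (Spr Tame trK Spr.tame)
open Summit.QuantumFields.BalabanUV.Beta.GAN24.DirichletExhaustionDeltaZ (summand deltaZ c166Z kappaZ kappaZ_pos abs_summand_le
  abs_sum_sum_le)
open Summit.QuantumFields.BalabanUV.Beta.GAN24.DirichletExhaustionDeltaZSymm (kerRe_neg summand_swap)
open Summit.QuantumFields.BalabanUV.Beta.GAN24.DirichletExhaustionDecays (toMKer)

/-! ## §1 The objects -/

/-- [our object] **Bałaban's unit-lattice block-field action kernel `Δ^{(n)}` for EVERY block size `n`**, in `MKer 4 (Fin 4)` currency: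
`CunZ n y y′ β β′ = Σ_{μ ≠ ν} summand (K^{(n)}_{μν;··}) μ ν β β′ (y − y′)`, `K^{(n)}_{μν;ab} = kerRe n μ ν a b` (the real part of the
`ℤ⁴`-Fourier coefficient of the continued (1.66) entry symbol).  VERBATIM gan24-p2's `deltaZ L k` with `kerFamily L ·· k = kerRe (L^k)`
replaced by `kerRe n` (`CunZ_pow_eq_toMKer_deltaZ`).  CONTEXT: [Balaban1984PropagatorsI, (1.66) p. 29]; nothing printed asserted. -/
def CunZ (n : ℕ) [NeZero n] : MKer 4 (Fin 4) := fun y y' β β' =>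
  ∑ μ : Fin 4, ∑ ν : Fin 4, if μ = ν then 0 else summand (d := 3) (fun a b => kerRe (d := 3) n μ ν a b) μ ν β β' (y - y')

/-- [our object] **T3 — THE COARSE LEG CANDIDATE** `Cun n a := Δ^{(n)} + a·𝟙` on the bonds of the unit lattice (K-R2's reading of
`(Q Ga Q*)⁻¹`; the identification is K-R2's theorem, NOT asserted here).  A DEFINITION; asserts nothing. -/
def Cun (n : ℕ) [NeZero n] (a : ℝ) : MKer 4 (Fin 4) := CunZ n + a • (idK : MKer 4 (Fin 4))

variable (n : ℕ) [NeZero n] (a : ℝ)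

/-- [our object] Unfolding `CunZ`. -/
theorem CunZ_apply (y y' : Site 4) (β β' : Fin 4) : CunZ n y y' β β' =
    ∑ μ : Fin 4, ∑ ν : Fin 4, if μ = ν then 0 else summand (d := 3) (fun a b => kerRe (d := 3) n μ ν a b) μ ν β β' (y - y') := rfl

/-- [our object] Unfolding `Cun`: `Cun n a y y′ β β′ = CunZ n y y′ β β′ + a·[y = y′ ∧ β = β′]`. -/
theorem Cun_apply (y y' : Site 4) (β β' : Fin 4) :
    Cun n a y y' β β' = CunZ n y y' β β' + a * (if y = y' ∧ β = β' then 1 else 0) := by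
  simp only [Cun, Pi.add_apply, Pi.smul_apply, smul_eq_mul, idK_apply]

/-- [folklore] **ALONG THE SCALE LADDER `n = L^k` THE OBJECT IS gan24-p2's `deltaZ`**: `CunZ (L^k) = toMKer (deltaZ L k)` — so the G-an2-4
theorems (`deltaZ_abs_le`, `deltaZ_symm`, `opClose_deltaZ`, `convC_deltaZ`, `decayCauchy_deltaZ`) are theorems about `CunZ` BY NAME. -/
theorem CunZ_pow_eq_toMKer_deltaZ (L : ℕ) [NeZero L] (k : ℕ) : CunZ (L ^ k) = toMKer (deltaZ (d := 3) L k) := by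
  funext y y' β β'
  rfl

/-- [folklore] Entrywise form of the same dictionary. -/
theorem CunZ_pow_apply (L : ℕ) [NeZero L] (k : ℕ) (y y' : Site 4) (β β' : Fin 4) :
    CunZ (L ^ k) y y' β β' = deltaZ (d := 3) L k (y, β) (y', β') := by
  rw [CunZ_pow_eq_toMKer_deltaZ]
  rfl

/-! ## §2 `n`-uniform exponential decay on the unit lattice (ℓ¹ currency), tameness -/

/-- [folklore] **THE `n`-UNIFORM ENTRY BOUND** `|CunZ n y y′ β β′| ≤ c166Z(3)·e^{−kappaZ(3)·|y − y′|₁}` — every block size `n ≥ 1`, all bonds;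
`c166Z 3 = 4·4²·MG 4`, `kappaZ 3 = κ₁₆₆(4)/4` (t4-ne2-p2's `kerRe_decay` per entry, gan24-p2's `abs_summand_le`/`abs_sum_sum_le` for the sum). -/
theorem abs_CunZ_le (y y' : Site 4) (β β' : Fin 4) :
    |CunZ n y y' β β'| ≤ c166Z 3 * Real.exp (-(kappaZ 3) * l1 (y - y')) := by
  have hE : ∀ μ ν : Fin 4, μ ≠ ν → ∀ a b : Fin 4,
      |(fun a b => kerRe (d := 3) n μ ν a b) a b (y - y')| ≤ MG (3 + 1) * Real.exp (-(kappaZ 3) * l1 (y - y')) := by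
    intro μ ν hμν a b
    have h := kerRe_decay (d := 3) n hμν a b (y - y')
    simpa [kappaZ] using h
  have hB : 0 ≤ 4 * (MG (3 + 1) * Real.exp (-(kappaZ 3) * l1 (y - y'))) := by
    have := MG_pos (3 + 1); positivity
  rw [CunZ_apply]
  refine (abs_sum_sum_le hB fun μ ν hμν => abs_summand_le (hE μ ν hμν) μ ν β β').trans (le_of_eq ?_)
  simp only [c166Z]
  norm_num
  ring

/-- [folklore] **`Decays (CunZ n) (c166Z 3) (kappaZ 3)` FOR EVERY `n`** — the coarse leg's decay is UNIFORM IN THE BLOCK SIZE (the input of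
A5's «no fine loop ⇒ no `log n`»). -/
theorem decays_CunZ : Decays (CunZ n) (c166Z 3) (kappaZ 3) :=
  fun y y' β β' => abs_CunZ_le n y y' β β'

/-- [folklore] The `a·𝟙` shift decays at any rate with constant `|a|`. -/
theorem abs_smul_idK_le (y y' : Site 4) (β β' : Fin 4) (κ : ℝ) :
    |a * (if y = y' ∧ β = β' then (1 : ℝ) else 0)| ≤ |a| * Real.exp (-κ * l1 (y - y')) := by
  split_ifs with h
  · rw [h.1, sub_self]
    simp [l1]
  · rw [mul_zero, abs_zero]
    positivity

/-- [folklore] **`Decays (Cun n a) (c166Z 3 + |a|) (kappaZ 3)` FOR EVERY `n`.** -/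
theorem decays_Cun : Decays (Cun n a) (c166Z 3 + |a|) (kappaZ 3) := by
  intro y y' β β'
  rw [Cun_apply, add_mul]
  exact (abs_add_le _ _).trans (add_le_add (abs_CunZ_le n y y' β β') (abs_smul_idK_le a y y' β β' (kappaZ 3)))

/-- [folklore] `CunZ n` is a SPREAD kernel (`TameKernelCalculus.Spr`). -/
theorem spr_CunZ : Spr (CunZ n) := ⟨c166Z 3, kappaZ 3, kappaZ_pos 3, decays_CunZ n⟩

/-- [folklore] `Cun n a` is a SPREAD kernel. -/
theorem spr_Cun : Spr (Cun n a) := ⟨c166Z 3 + |a|, kappaZ 3, kappaZ_pos 3, decays_Cun n a⟩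

/-- [folklore] `CunZ n` is TAME (row and column majorants + uniform bound: `Spr.tame`) — unlike the gluon leg, the coarse leg's rows ARE summable. -/
theorem tame_CunZ : Tame (CunZ n) := (spr_CunZ n).tame

/-- [folklore] `Cun n a` is TAME. -/
theorem tame_Cun : Tame (Cun n a) := (spr_Cun n a).tame

/-- [folklore] Uniform entry bound `|Cun n a y y′ β β′| ≤ c166Z 3 + |a|` (`KernelWard.Bdd`). -/
theorem bdd_Cun : Bdd (Cun n a) (c166Z 3 + |a|) := by
  intro y y' β β'
  refine (decays_Cun n a y y' β β').trans ?_
  have hC : 0 ≤ c166Z 3 + |a| := by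
    have := MG_pos (3 + 1)
    have h1 : 0 ≤ c166Z 3 := by simp only [c166Z]; positivity
    positivity
  have hexp : Real.exp (-(kappaZ 3) * l1 (y - y')) ≤ 1 := by
    rw [Real.exp_le_one_iff]
    have := kappaZ_pos 3
    have := l1_nonneg (y - y')
    nlinarith
  calc (c166Z 3 + |a|) * Real.exp (-(kappaZ 3) * l1 (y - y')) ≤ (c166Z 3 + |a|) * 1 :=
        mul_le_mul_of_nonneg_left hexp hC
    _ = c166Z 3 + |a| := mul_one _

/-! ## §3 Symmetry and unit-lattice translation invariance -/

/-- [folklore] **`CunZ n` IS SYMMETRIC**: `CunZ n y y′ β β′ = CunZ n y′ y β′ β` (reflection law `kerRe_neg` of the entry kernels + `summand_swap`,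
exactly as gan24-p2's `deltaZ_symm`, for every `n`). -/
theorem CunZ_symm (y y' : Site 4) (β β' : Fin 4) : CunZ n y y' β β' = CunZ n y' y β' β := by
  rw [CunZ_apply, CunZ_apply]
  refine Finset.sum_congr rfl fun μ _ => Finset.sum_congr rfl fun ν _ => ?_
  split_ifs with h
  · rfl
  · have hz : y' - y = -(y - y') := by abel
    rw [hz, summand_swap (fun a b z => ?_) μ ν β β' (y - y')]
    exact kerRe_neg (d := 3) n h a b z

/-- [folklore] **`Cun n a` IS SYMMETRIC.** -/
theorem Cun_symm (y y' : Site 4) (β β' : Fin 4) : Cun n a y y' β β' = Cun n a y' y β' β := by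
  rw [Cun_apply, Cun_apply, CunZ_symm n y y' β β']
  congr 2
  by_cases h : y = y' ∧ β = β'
  · rw [if_pos h, if_pos ⟨h.1.symm, h.2.symm⟩]
  · have h' : ¬(y' = y ∧ β' = β) := fun hh => h ⟨hh.1.symm, hh.2.symm⟩
    rw [if_neg h, if_neg h']

/-- [folklore] The same in transposition currency: `trK (Cun n a) = Cun n a`. -/
theorem trK_Cun : trK (Cun n a) = Cun n a := by
  funext y y' β β'
  exact (Cun_symm n a y y' β β').symm

/-- [folklore] **UNIT-LATTICE TRANSLATION INVARIANCE of `CunZ`**: `shiftK v (CunZ n) = CunZ n` for EVERY `v ∈ ℤ⁴` (the kernel is a function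
of `y − y′`). -/
theorem shiftK_CunZ (v : Site 4) : shiftK v (CunZ n) = CunZ n := by
  funext y y' β β'
  simp only [shiftK, CunZ_apply, add_sub_add_right_eq_sub]

/-- [folklore] **UNIT-LATTICE TRANSLATION INVARIANCE of `Cun`**: `shiftK v (Cun n a) = Cun n a` for every `v` — in particular the `covA` field
of `ExpKernelCalculus.BlockCovariant` at ANY period. -/
theorem shiftK_Cun (v : Site 4) : shiftK v (Cun n a) = Cun n a := by
  funext y y' β β'
  simp only [shiftK, Cun_apply, add_sub_add_right_eq_sub, add_left_inj, CunZ_apply]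

end Summit.QuantumFields.BalabanUV.Beta.D1BFx.CoarseLeg

end
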